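import Literature.AlgebraicGeometry.Resolution.NonPrincipalLocus
import Literature.AlgebraicGeometry.Resolution.PrimeDivisorIdeals
import Literature.AlgebraicGeometry.Resolution.DivisorialPartLemmas
import Literature.AlgebraicGeometry.Resolution.HypersurfaceTransform
import Literature.AlgebraicGeometry.Resolution.SncStrata
import HarnessLib

/-!
# The divisorial part of an ideal sheaf on a regular scheme (Cossart–Piltant 2008, proof of Prop. 4.2)

Topic: `Literature/AlgebraicGeometry/Resolution`. Fourth brick under the named fact
`CossartPiltant2019Principalization` (`Principalization.lean`): the first paragraph of the
printed proof of [CoP1] = Cossart–Piltant, J. Algebra 320 (2008), Prop. 4.2 (PDF p. 7),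

> "Let `E_1, …, E_m` be the irreducible components of codimension one of `Z := V(I)_red`, and
> `a(j) := ord_{E_j} I`, `1 ≤ j ≤ m`. Then `H := 𝒪_X(-∑_{1≤i≤m} a(i)E_i) ⊆ I`, and
> `J := H⁻¹ I ⊆ 𝒪_X` is such that `V(J)` has codimension at least two in `X`. … Clearly
> `I` is locally principal ⇔ `μ = 0` ⇔ `J = 𝒪_X`."

PROVED here for a non-zero ideal sheaf `I` on a regular integral Noetherian scheme `X` (where
"regular" enters through Auslander–Buchsbaum: the local rings are factorial, so the prime
divisors `E_i` are Cartier, `PrimeDivisorIdeals.lean`):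

* `divisorialPoints I` — the codimension-one points of `V(I)` (the generic points of the
  `E_i`); `finite_divisorialPoints`;
* `divisorialPart I = ∏ᵢ 𝓘_{E_i}^{a(i)}` (`a(i) = ord_{E_i} I`, `idealOrder` at the generic
  point) — the ideal sheaf `H = 𝒪_X(-∑ a(i) E_i)`; `isEffectiveCartier_divisorialPart` (`H` is
  invertible); `stalkIdeal_divisorialPart` (its stalks `(∏ p_i^{a(i)})`);
  **`le_divisorialPart`: `I ⊆ H`**;
* `codimTwoPart I := (I : H)` — the ideal sheaf `J = H⁻¹ I`;
  **`divisorialPart_mul_codimTwoPart`: `H · J = I`**; `le_codimTwoPart` (`I ⊆ J`);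
* **`one_lt_coheight_of_mem_support_codimTwoPart`: "`V(J)` has codimension at least two"** —
  no point of codimension `≤ 1` lies in `V(J)`;
* **`coe_support_codimTwoPart`: `V(J)` is exactly the non-locally-principal locus of `I`**
  (`nonPrincipalLocus`, `NonPrincipalLocus.lean`) — in particular "`I` is locally principal ⇔
  `J = 𝒪_X`" (`isLocallyPrincipal_iff_codimTwoPart_eq_top`); the inclusion `⊆` is Krull's
  Hauptidealsatz in `𝒪_{X,x}` (a proper principal `J_x` would put a codimension-one point in
  `V(J)`);
* `exists_divisorial_decomposition` — the package consumed by the induction on `μ`.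

## Sources

* V. Cossart, O. Piltant, *Resolution of singularities of threefolds in positive
  characteristic. I*, J. Algebra 320 (2008) 1051–1082, proof of Prop. 4.2 (PDF p. 7).
  [CossartPiltant2008]
* U. Görtz, T. Wedhorn, *Algebraic Geometry I*, 2nd ed. (2020), Thm. 11.40 (2) (Weil divisors on
  locally factorial schemes are Cartier). [GortzWedhorn2020]
* The Stacks Project, Tags 0BE1, 00KV, 01J7. [StacksProject]

## What is NOT here

The order `μ = max ord_x J`, the locus `Σ`, and the induction — later bricks.
-/

noncomputable section

open CategoryTheory CategoryTheory.Limits AlgebraicGeometry TopologicalSpace IsLocalRing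

namespace Literature.AlgebraicGeometry.Resolution

universe u

open Scheme.IdealSheafData

variable {X : Scheme.{u}}

/-! ## The codimension-one points of `V(I)` -/

/-- **The codimension-one points of `V(I)`** — the generic points of the irreducible components
`E_1, …, E_m` of codimension one of `V(I)_red` ([CoP1], proof of Prop. 4.2).
[cite: CossartPiltant2008, proof of Prop. 4.2] -/
def divisorialPoints (I : X.IdealSheafData) : Set X :=
  {ζ | ζ ∈ I.support ∧ Order.coheight ζ = 1}

/-- Membership in `divisorialPoints`. [folklore] -/
theorem mem_divisorialPoints_iff (I : X.IdealSheafData) (ζ : X) :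
    ζ ∈ divisorialPoints I ↔ ζ ∈ I.support ∧ Order.coheight ζ = 1 :=
  Iff.rfl

/-- **`V(I)` has finitely many codimension-one points** for a non-zero ideal sheaf on a
Noetherian integral scheme. [cite: StacksProject, Tag 0BE1] -/
theorem finite_divisorialPoints [IsIntegral X] [IsNoetherian X] {I : X.IdealSheafData}
    (hI : I ≠ ⊥) : (divisorialPoints I).Finite :=
  finite_setOf_mem_and_coheight_eq_one I.support.isClosed (not_mem_support_genericPoint hI)

/-! ## The divisorial part `H = 𝒪_X(-∑ a(i) E_i)` -/

/-- **The divisorial part `H := 𝒪_X(-∑ᵢ a(i) E_i) = ∏ᵢ 𝓘_{E_i}^{a(i)}`** of the ideal sheaf `I`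
([CoP1], proof of Prop. 4.2), the product over the codimension-one points `ζᵢ` of `V(I)` of the
powers `𝓘_{E_i}^{a(i)}`, `E_i = cl{ζᵢ}`, `a(i) = ord_{ζᵢ} I`. (Junk value `𝒪_X` if `V(I)` has
infinitely many codimension-one points, which does not happen for `I ≠ 0` on a Noetherian
integral scheme, `finite_divisorialPoints`.) [cite: CossartPiltant2008, proof of Prop. 4.2] -/
def divisorialPart (I : X.IdealSheafData) : X.IdealSheafData := by
  classical
  exact if h : (divisorialPoints I).Finite then
    ∏ ζ ∈ h.toFinset, primeDivisorIdeal ζ ^ (idealOrder I ζ).toNat else ⊤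

/-- Unfolding `divisorialPart` over the finite set of codimension-one points. [folklore] -/
theorem divisorialPart_eq {I : X.IdealSheafData} (h : (divisorialPoints I).Finite) :
    divisorialPart I = ∏ ζ ∈ h.toFinset, primeDivisorIdeal ζ ^ (idealOrder I ζ).toNat := by
  classical
  rw [divisorialPart, dif_pos h]

/-! ## The part of codimension `≥ 2`: `J = H⁻¹ I` -/

/-- **`J := H⁻¹ I = (I : H)`**, the ideal sheaf left after removing the divisorial part
([CoP1], proof of Prop. 4.2). [cite: CossartPiltant2008, proof of Prop. 4.2] -/
def codimTwoPart (I : X.IdealSheafData) : X.IdealSheafData :=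
  colon I (divisorialPart I)

/-- `I ⊆ J`. [folklore] -/
theorem le_codimTwoPart (I : X.IdealSheafData) : I ≤ codimTwoPart I :=
  le_colon_self _ _

/-- The stalks of `J = (I : H)` on a locally Noetherian scheme: `J_x = (I_x : H_x)`. [folklore] -/
theorem stalkIdeal_codimTwoPart [IsLocallyNoetherian X] (I : X.IdealSheafData) (x : X) :
    stalkIdeal (codimTwoPart I) x =
      Submodule.colon (stalkIdeal I x) (stalkIdeal (divisorialPart I) x : Set _) :=
  stalkIdeal_colon _ _ _

/-- At a codimension-one point `ζ` of `V(I)` on a regular integral scheme: `I_ζ = 𝔪_ζ^{a}` with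
`a = ord_ζ I ∈ ℕ`. [cite: CossartPiltant2008, proof of Prop. 4.2] -/
theorem stalkIdeal_eq_pow_of_mem_divisorialPoints [IsIntegral X] (hX : Scheme.IsRegular X)
    {I : X.IdealSheafData} (hI : I ≠ ⊥) {ζ : X} (hζ : ζ ∈ divisorialPoints I) :
    stalkIdeal I ζ = maximalIdeal (X.presheaf.stalk ζ) ^ (idealOrder I ζ).toNat := by
  obtain ⟨a, ha, he⟩ := exists_stalkIdeal_eq_maximalIdeal_pow hX hζ.2 hI
  rw [he, ha]
  rfl

/-- **`I ⊆ 𝓘_{E_i}^{a(i)}`** for each codimension-one point of `V(I)` (regular integral `X`).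
[cite: CossartPiltant2008, proof of Prop. 4.2] -/
theorem le_primeDivisorIdeal_pow_of_mem_divisorialPoints [IsIntegral X] (hX : Scheme.IsRegular X)
    {I : X.IdealSheafData} (hI : I ≠ ⊥) {ζ : X} (hζ : ζ ∈ divisorialPoints I) :
    I ≤ primeDivisorIdeal ζ ^ (idealOrder I ζ).toNat :=
  le_primeDivisorIdeal_pow_of_isRegular hX hζ.2
    (stalkIdeal_eq_pow_of_mem_divisorialPoints hX hI hζ).le

section Regular

variable [IsIntegral X] [IsNoetherian X] (hX : Scheme.IsRegular X) {I : X.IdealSheafData}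
  (hI : I ≠ ⊥)

include hX hI

/-- **`H` is invertible**: the divisorial part is an effective Cartier divisor (a product of
powers of the Cartier divisors `E_i`). [cite: CossartPiltant2008, proof of Prop. 4.2] -/
theorem isEffectiveCartier_divisorialPart : IsEffectiveCartier (divisorialPart I) := by
  rw [divisorialPart_eq (finite_divisorialPoints hI)]
  refine IsEffectiveCartier.finset_prod _ fun ζ hζ => IsEffectiveCartier.pow ?_ _
  rw [Set.Finite.mem_toFinset, mem_divisorialPoints_iff] at hζ
  exact isEffectiveCartier_primeDivisorIdeal_of_isRegular hX hζ.2

/-- **The stalks of `H`**: `H_x` is generated by one element `h = ∏_{ζ ⤳ x} p_ζ^{a(ζ)}` (prime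
generators `p_ζ` of the primes `𝔭_ζ ⊆ 𝒪_{X,x}` of the codimension-one points `ζ ⤳ x` of
`V(I)`), and `h` divides every `f ∈ I_x` — the `p_ζ` being pairwise non-associated, as distinct
codimension-one generisations have distinct primes (Stacks 01J7).
[cite: CossartPiltant2008, proof of Prop. 4.2] -/
theorem exists_stalkIdeal_divisorialPart_eq_span (x : X) :
    ∃ h : X.presheaf.stalk x, stalkIdeal (divisorialPart I) x = Ideal.span {h} ∧
      ∀ f ∈ stalkIdeal I x, h ∣ f := by
  classical
  haveI := hX.uniqueFactorizationMonoid_stalk x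
  set T := (finite_divisorialPoints hI).toFinset with hT
  have hTmem : ∀ ζ ∈ T, ζ ∈ divisorialPoints I := fun ζ h => (Set.Finite.mem_toFinset _).mp h
  -- prime generators of `𝔭_ζ` for the generisations `ζ ⤳ x` in `T`
  have hq : ∀ ζ : {ζ // ζ ∈ T ∧ ζ ⤳ x}, ∃ q : X.presheaf.stalk x,
      Prime q ∧ primeOfSpecializes ζ.2.2 = Ideal.span {q} :=
    fun ζ => exists_prime_primeOfSpecializes_eq_span ζ.2.2 (hTmem ζ ζ.2.1).2
  choose q hqprime hqspan using hq
  let q' : X → X.presheaf.stalk x := fun ζ => if h : ζ ∈ T ∧ ζ ⤳ x then q ⟨ζ, h⟩ else 1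
  have hq'_pos : ∀ (ζ : X) (h : ζ ∈ T ∧ ζ ⤳ x), q' ζ = q ⟨ζ, h⟩ := fun ζ h => dif_pos h
  have hq'_neg : ∀ ζ : X, ¬ ζ ⤳ x → q' ζ = 1 := fun ζ h => dif_neg fun hh => h hh.2
  have hstalk : ∀ ζ ∈ T, stalkIdeal (primeDivisorIdeal ζ) x = Ideal.span {q' ζ} := by
    intro ζ hζ
    by_cases h : ζ ⤳ x
    · rw [hq'_pos ζ ⟨hζ, h⟩, stalkIdeal_primeDivisorIdeal h]
      exact hqspan ⟨ζ, hζ, h⟩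
    · rw [hq'_neg ζ h, stalkIdeal_primeDivisorIdeal_eq_top h, Ideal.span_singleton_one]
  refine ⟨∏ ζ ∈ T, q' ζ ^ (idealOrder I ζ).toNat, ?_, ?_⟩
  · rw [divisorialPart_eq (finite_divisorialPoints hI), stalkIdeal_finset_prod,
      ← Ideal.prod_span_singleton]
    refine Finset.prod_congr rfl fun ζ hζ => ?_
    rw [stalkIdeal_pow, hstalk ζ hζ, Ideal.span_singleton_pow]
  · intro f hf
    -- only the generisations of `x` contribute
    have hsplit : ∏ ζ ∈ T, q' ζ ^ (idealOrder I ζ).toNat =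
        ∏ ζ ∈ T.filter (· ⤳ x), q' ζ ^ (idealOrder I ζ).toNat := by
      rw [Finset.prod_filter]
      refine Finset.prod_congr rfl fun ζ _ => ?_
      split_ifs with h
      · rfl
      · rw [hq'_neg ζ h, one_pow]
    rw [hsplit]
    refine Finset.prod_pow_dvd_of_forall_pow_dvd q' _ _ ?_ ?_ ?_
    · intro ζ hζ
      obtain ⟨hζT, h⟩ := Finset.mem_filter.mp hζ
      rw [hq'_pos ζ ⟨hζT, h⟩]
      exact hqprime _
    · intro ζ hζ ζ' hζ' hne hdvd
      obtain ⟨hζT, h⟩ := Finset.mem_filter.mp hζ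
      obtain ⟨hζ'T, h'⟩ := Finset.mem_filter.mp hζ'
      have hle : primeOfSpecializes h' ≤ primeOfSpecializes h := by
        rw [hqspan ⟨ζ, hζT, h⟩, hqspan ⟨ζ', hζ'T, h'⟩, ← hq'_pos ζ ⟨hζT, h⟩,
          ← hq'_pos ζ' ⟨hζ'T, h'⟩]
        exact Ideal.span_singleton_le_span_singleton.mpr hdvd
      exact not_specializes_of_coheight_eq_one (hTmem ζ' hζ'T).2 (hTmem ζ hζT).2 (Ne.symm hne)
        (specializes_of_primeOfSpecializes_le h h' hle)
    · intro ζ hζ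
      obtain ⟨hζT, -⟩ := Finset.mem_filter.mp hζ
      have h1 : f ∈ stalkIdeal (primeDivisorIdeal ζ ^ (idealOrder I ζ).toNat) x :=
        stalkIdeal_mono (le_primeDivisorIdeal_pow_of_mem_divisorialPoints hX hI (hTmem ζ hζT)) x hf
      rw [stalkIdeal_pow, hstalk ζ hζT, Ideal.span_singleton_pow, Ideal.mem_span_singleton] at h1
      exact h1

/-- **`H ⊆ I`, i.e. `I ⊆ 𝒪_X(-∑ a(i)E_i)`** ([CoP1], proof of Prop. 4.2: "Then
`H := 𝒪_X(-∑ a(i)E_i) ⊆ I`" — in the multiplicative notation of ideal sheaves, `I ≤ H`).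
[cite: CossartPiltant2008, proof of Prop. 4.2] -/
theorem le_divisorialPart : I ≤ divisorialPart I := by
  refine le_of_forall_stalkIdeal_le fun x => ?_
  obtain ⟨h, hh, hdvd⟩ := exists_stalkIdeal_divisorialPart_eq_span hX hI x
  rw [hh]
  exact fun f hf => Ideal.mem_span_singleton.mpr (hdvd f hf)

/-- At a codimension-one point `ζ` of `V(I)`, `H_ζ = 𝔪_ζ^{a(ζ)} = I_ζ` (the other prime divisors
do not pass through `ζ`). [cite: CossartPiltant2008, proof of Prop. 4.2] -/
theorem stalkIdeal_divisorialPart_of_mem_divisorialPoints {ζ : X} (hζ : ζ ∈ divisorialPoints I) :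
    stalkIdeal (divisorialPart I) ζ = stalkIdeal I ζ := by
  classical
  have hfin := finite_divisorialPoints hI
  have hζT : ζ ∈ hfin.toFinset := (Set.Finite.mem_toFinset _).mpr hζ
  rw [divisorialPart_eq hfin, stalkIdeal_finset_prod, ← Finset.mul_prod_erase _ _ hζT,
    stalkIdeal_pow, stalkIdeal_primeDivisorIdeal_self,
    ← stalkIdeal_eq_pow_of_mem_divisorialPoints hX hI hζ, Finset.prod_eq_one, mul_one]
  intro ζ' hζ'
  obtain ⟨hne, hζ'T⟩ := Finset.mem_erase.mp hζ'
  have hζ' : ζ' ∈ divisorialPoints I := (Set.Finite.mem_toFinset _).mp hζ'T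
  rw [stalkIdeal_pow, stalkIdeal_primeDivisorIdeal_eq_top
    (not_specializes_of_coheight_eq_one hζ'.2 hζ.2 hne), Ideal.one_eq_top, Ideal.top_pow]

/-! ## `H · J = I`, and `V(J)` -/

/-- **`H · J = I`** ([CoP1]: `J := H⁻¹ I`): stalkwise `(h) · (I_x : h) = I_x` as `I_x ⊆ (h)`.
[cite: CossartPiltant2008, proof of Prop. 4.2] -/
theorem divisorialPart_mul_codimTwoPart : divisorialPart I * codimTwoPart I = I := by
  refine ext_of_forall_stalkIdeal_eq fun x => ?_
  obtain ⟨h, hh, hdvd⟩ := exists_stalkIdeal_divisorialPart_eq_span hX hI x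
  rw [stalkIdeal_mul, stalkIdeal_codimTwoPart I, hh]
  exact Ideal.span_singleton_mul_colon_of_le fun f hf => Ideal.mem_span_singleton.mpr (hdvd f hf)

/-- At a codimension-one point of `V(I)`, `J_ζ = 𝒪_{X,ζ}`. [cite: CossartPiltant2008, proof of Prop. 4.2] -/
theorem stalkIdeal_codimTwoPart_eq_top_of_mem_divisorialPoints {ζ : X}
    (hζ : ζ ∈ divisorialPoints I) : stalkIdeal (codimTwoPart I) ζ = ⊤ := by
  rw [stalkIdeal_codimTwoPart I, stalkIdeal_divisorialPart_of_mem_divisorialPoints hX hI hζ,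
    eq_top_iff]
  intro r _
  exact Submodule.mem_colon.mpr fun s hs => Ideal.mul_mem_left _ r hs

/-- **"`V(J)` has codimension at least two in `X`"** ([CoP1], proof of Prop. 4.2): every point
of `V(J)` has codimension `> 1` — the generic point and the codimension-one points off `V(I)`
have `I_x = 𝒪_{X,x} ⊆ J_x`, and at a codimension-one point of `V(I)` one has `J_ζ = 𝒪_{X,ζ}`.
[cite: CossartPiltant2008, proof of Prop. 4.2] -/
theorem one_lt_coheight_of_mem_support_codimTwoPart {x : X} (hx : x ∈ (codimTwoPart I).support) :
    1 < Order.coheight x := by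
  by_contra hle
  rw [not_lt] at hle
  have htop : stalkIdeal (codimTwoPart I) x = ⊤ := by
    by_cases hxI : x ∈ I.support
    · rcases eq_or_lt_of_le hle with h1 | h0
      · exact stalkIdeal_codimTwoPart_eq_top_of_mem_divisorialPoints hX hI ⟨hxI, h1⟩
      · exfalso
        rw [Order.lt_one_iff] at h0
        rw [eq_genericPoint_of_coheight_eq_zero h0] at hxI
        exact not_mem_support_genericPoint hI hxI
    · exact eq_top_iff.mpr ((stalkIdeal_eq_top_of_not_mem_support hxI).ge.trans
        (stalkIdeal_mono (le_codimTwoPart I) x))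
  rw [mem_support_iff_stalkIdeal_le, htop, top_le_iff] at hx
  exact (maximalIdeal.isMaximal (X.presheaf.stalk x)).ne_top hx

/-- **`V(J)` is the non-locally-principal locus of `I`** ([CoP1]: "`I` is locally principal ⇔
`μ = 0` ⇔ `J = 𝒪_X`", pointwise): off `V(J)`, `I_x = H_x` is principal; at `x ∈ V(J)`, were
`I_x = (f)` principal, cancelling the invertible `H_x = (h)` in `(h) J_x = (f)` would make `J_x`
a proper non-zero principal ideal, whose height-one primes (Krull) are codimension-one points
of `V(J)` — excluded. [cite: CossartPiltant2008, proof of Prop. 4.2] -/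
theorem coe_support_codimTwoPart :
    ((codimTwoPart I).support : Set X) = (nonPrincipalLocus I : Set X) := by
  ext x
  constructor
  · intro hx hprin
    obtain ⟨f, hf⟩ := hprin.isPrincipal_stalkIdeal
    replace hf : stalkIdeal I x = Ideal.span {f} := hf
    obtain ⟨h, hh, -⟩ := exists_stalkIdeal_divisorialPart_eq_span hX hI x
    have hI0 : stalkIdeal I x ≠ ⊥ := stalkIdeal_ne_bot_of_ne_bot hI x
    have hh0 : h ≠ 0 := by
      rintro rfl
      apply hI0
      rw [Ideal.span_singleton_eq_bot.mpr rfl] at hh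
      exact le_bot_iff.mp (hh ▸ stalkIdeal_mono (le_divisorialPart hX hI) x)
    have e : Ideal.span {h} * stalkIdeal (codimTwoPart I) x = Ideal.span {f} := by
      rw [← hh, ← hf, ← stalkIdeal_mul, divisorialPart_mul_codimTwoPart hX hI]
    obtain ⟨g, hg, hJg⟩ := Ideal.exists_eq_span_singleton_of_span_singleton_mul_eq hh0 e
    haveI := hX x
    -- `g` is a non-zero non-unit
    have hg0 : g ≠ 0 := by
      rintro rfl
      rw [Ideal.span_singleton_eq_bot.mpr rfl] at hJg
      exact hI0 (le_bot_iff.mp (hJg ▸ stalkIdeal_mono (le_codimTwoPart I) x))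
    have hgu : ¬ IsUnit g := by
      intro hu
      have := (mem_support_iff_stalkIdeal_le _ x).mp hx
      rw [hJg, Ideal.span_singleton_le_iff_mem] at this
      exact (mem_maximalIdeal _).mp this hu
    -- a height-one prime over `g`, i.e. a codimension-one generisation `ζ ⤳ x` in `V(J)`
    obtain ⟨P, hP, hP1, hgP⟩ := Ideal.exists_height_eq_one_of_mem_nonunits hg0 hgu
    haveI := hP
    obtain ⟨ζ, hζx, hPζ⟩ := exists_specializes_comap_stalkSpecializes_eq x P
    have hcoh : Order.coheight ζ = 1 := by
      have h1 := coe_height_primeOfSpecializes hζx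
      rw [primeOfSpecializes, ← hPζ, hP1] at h1
      exact_mod_cast h1.symm
    have hζsupp : ζ ∈ (codimTwoPart I).support := by
      rw [mem_support_iff_stalkIdeal_le, ← stalkIdeal_map_stalkSpecializes _ hζx, hJg,
        Ideal.map_span, Set.image_singleton, Ideal.span_singleton_le_iff_mem]
      have : g ∈ primeOfSpecializes hζx := by rw [primeOfSpecializes, ← hPζ]; exact hgP
      exact this
    exact absurd (one_lt_coheight_of_mem_support_codimTwoPart hX hI hζsupp) (by rw [hcoh]; decide)
  · intro hx
    by_contra hx'
    apply hx
    obtain ⟨h, hh, -⟩ := exists_stalkIdeal_divisorialPart_eq_span hX hI x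
    refine isLocallyPrincipalAt_of_isPrincipal_stalkIdeal ⟨h, ?_⟩
    change stalkIdeal I x = Ideal.span {h}
    rw [← divisorialPart_mul_codimTwoPart hX hI, stalkIdeal_mul, hh,
      stalkIdeal_eq_top_of_not_mem_support hx', Ideal.mul_top]

/-- **"`I` is locally principal ⇔ `J = 𝒪_X`"** ([CoP1], proof of Prop. 4.2).
[cite: CossartPiltant2008, proof of Prop. 4.2] -/
theorem isLocallyPrincipal_iff_codimTwoPart_eq_top :
    IsLocallyPrincipal I ↔ codimTwoPart I = ⊤ := by
  rw [← nonPrincipalLocus_eq_bot_iff, ← support_eq_bot_iff,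
    SetLike.ext'_iff (p := nonPrincipalLocus I), SetLike.ext'_iff (p := (codimTwoPart I).support),
    coe_support_codimTwoPart hX hI]

/-- `x ∈ V(J)` iff `I` is not locally principal at `x`. [cite: CossartPiltant2008, proof of Prop. 4.2] -/
theorem mem_support_codimTwoPart_iff (x : X) :
    x ∈ (codimTwoPart I).support ↔ ¬ IsLocallyPrincipalAt I x := by
  rw [← mem_nonPrincipalLocus_iff, ← SetLike.mem_coe, coe_support_codimTwoPart hX hI,
    SetLike.mem_coe]

/-- **The divisorial decomposition, packaged** ([CoP1], proof of Prop. 4.2, first paragraph):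
a non-zero ideal sheaf `I` on a regular integral Noetherian scheme factors as `I = H · J` with
`H` an effective Cartier divisor (invertible), `I ⊆ J`, `V(J)` equal to the locus where `I` is
not locally principal, and `V(J)` of codimension `≥ 2`. [cite: CossartPiltant2008, proof of Prop. 4.2] -/
theorem exists_divisorial_decomposition :
    ∃ H J : X.IdealSheafData, IsEffectiveCartier H ∧ H * J = I ∧ I ≤ J ∧
      ((J.support : Set X) = (nonPrincipalLocus I : Set X)) ∧
      ∀ x ∈ J.support, 1 < Order.coheight x :=
  ⟨divisorialPart I, codimTwoPart I, isEffectiveCartier_divisorialPart hX hI,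
    divisorialPart_mul_codimTwoPart hX hI, le_codimTwoPart I, coe_support_codimTwoPart hX hI,
    fun _ hx => one_lt_coheight_of_mem_support_codimTwoPart hX hI hx⟩

end Regular

end Literature.AlgebraicGeometry.Resolution

end
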